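import Mathlib
import Summits.KontsevichZagierPeriods.Zeta5Search.TwoTaleOmega.OmegaKit

/-!
# (bmiss)@Ω — instance kit for the SECOND-TALE sides (`X/R`)

HONEST FRAMING: systematic search; no irrationality claim unless certified. Pure finite algebra over `ℚ`; no named
fact, no `sorry`.

What every second-tale data identity (blueprint `RECURRENCE.md` §13, sides `R`) needs on top of `OmegaKit`:

* `facZ` bookkeeping (`facZ_ne_zero`, `facZ_succ`, `facZ_add_nat`);
* `eval_block2_half : (block2 lo hi).eval (u/2) = (block lo hi).eval u` — in the lattice variable `u = 2t` the doubled
  block is an ordinary block, so its shift law is `FormalBarnesKit.eval_block_succ_mul` (twice for `u ↦ u + 2`);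
* the hinge's second-tale objects spelled out: `numT_eq`, `denT_eq`, `normT_eq`, `Pi_eq`, the packaged constant
  `Pt.kap = ε_p Π(p)⁻¹ Π̂(p) = ε_p (e−1)!(f−a+e−1)!(f−1)!/(g−b−1)!` (`kap_eq`) and the normal form of the value
  `vR_eval_blocks : vR(p)(u) = kap · block(a+1, g−b+a)(u) · block(a−b+1, f)(u/2) / (block(e, e+f)(u/2) · block(a, g)(u/2))`;
* motion along `δ_b`: `eps_addB`, `kap_addB`.
-/

noncomputable section

open Finset Polynomial
open Literature.NumberTheory.Irrationality.Zudilin2014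
open Summit.KontsevichZagierPeriods.Zeta5Search.FormalBarnes

namespace Summit.KontsevichZagierPeriods.Zeta5Search.TwoTaleOmega

/-! ### `facZ` and `block2` bookkeeping -/

/-- `facZ m ≠ 0`. -/
theorem facZ_ne_zero (m : ℤ) : facZ m ≠ 0 := by unfold facZ; positivity

/-- `facZ (m+1) = (m+1) · facZ m` for `m ≥ 0`. -/
theorem facZ_succ {m : ℤ} (h : 0 ≤ m) : facZ (m + 1) = ((m : ℚ) + 1) * facZ m := by
  unfold facZ
  rw [show (m + 1).toNat = m.toNat + 1 by omega, Nat.factorial_succ]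
  push_cast
  rw [show ((m.toNat : ℕ) : ℚ) = (m : ℚ) by exact_mod_cast Int.toNat_of_nonneg h]

/-- `facZ (m+k) = facZ m · ∏_{j<k} (m+j+1)` for `m ≥ 0`. -/
theorem facZ_add_nat {m : ℤ} (h : 0 ≤ m) (k : ℕ) :
    facZ (m + k) = facZ m * ∏ j ∈ range k, ((m : ℚ) + j + 1) := by
  induction k with
  | zero => simp
  | succ k ih =>
    rw [prod_range_succ, ← mul_assoc, ← ih, show (m + ((k + 1 : ℕ) : ℤ)) = m + k + 1 by push_cast; ring,
      facZ_succ (by omega)]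
    push_cast; ring

/-- In the lattice variable the doubled block is an ordinary block: `block2 lo hi (u/2) = block lo hi (u)`. -/
theorem eval_block2_half (lo hi : ℤ) (u : ℚ) : (block2 lo hi).eval (u / 2) = (block lo hi).eval u := by
  rw [eval_block2, eval_block]
  exact prod_congr rfl fun l _ => by ring

namespace Pt

variable (p : Pt)

/-! ### The second-tale objects of the hinge, spelled out -/

/-- `â₀ = g − b + a`. -/ theorem t2a_zero : p.t2a 0 = p.g - p.b + p.a := rfl
/-- `â₁ = f`. -/ theorem t2a_one : p.t2a 1 = p.f := rfl
/-- `â₂ = e`. -/ theorem t2a_two : p.t2a 2 = p.e := rfl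
/-- `â₃ = a`. -/ theorem t2a_three : p.t2a 3 = p.a := rfl
/-- `b̂₀ = a + 1`. -/ theorem t2b_zero : p.t2b 0 = p.a + 1 := rfl
/-- `b̂₁ = a − b + 1`. -/ theorem t2b_one : p.t2b 1 = p.a - p.b + 1 := rfl
/-- `b̂₂ = e + f`. -/ theorem t2b_two : p.t2b 2 = p.e + p.f := rfl
/-- `b̂₃ = g`. -/ theorem t2b_three : p.t2b 3 = p.g := rfl

/-- `numT` of the hinge. -/
theorem numT_eq : numT p.t2a p.t2b
    = C (normT p.t2a p.t2b) * (block2 (p.a + 1) (p.g - p.b + p.a) * block (p.a - p.b + 1) p.f) := rfl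

/-- `denT` of the hinge. -/
theorem denT_eq : denT p.t2a p.t2b = block p.e (p.e + p.f) * block p.a p.g := rfl

/-- `Π̂` of the hinge: `(f−1)!(g−a−1)!/((g−b−1)!(f−a+b−1)!)`. -/
theorem normT_eq : normT p.t2a p.t2b
    = facZ (p.f - 1) * facZ (p.g - p.a - 1) / (facZ (p.g - p.b - 1) * facZ (p.f - p.a + p.b - 1)) := by
  unfold normT
  rw [t2a_zero, t2a_one, t2a_two, t2a_three, t2b_zero, t2b_one, t2b_two, t2b_three,
    show p.e + p.f - p.e - 1 = p.f - 1 by ring, show p.g - p.b + p.a - (p.a + 1) = p.g - p.b - 1 by ring,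
    show p.f - (p.a - p.b + 1) = p.f - p.a + p.b - 1 by ring]

/-- `Π` of the hinge: `(g−a−1)!/((e−1)!(f−a+e−1)!(b−a+f−1)!)`. -/
theorem Pi_eq : p.Pi = facZ (p.g - p.a - 1) / (facZ (p.e - 1) * facZ (p.f - p.a + p.e - 1) * facZ (p.b - p.a + p.f - 1)) := by
  show facZ (p.t1b 3 - p.t1a 3 - 1) / (facZ (p.t1a 0 - p.t1b 0) * facZ (p.t1a 1 - p.t1b 1) * facZ (p.t1a 2 - p.t1b 2)) = _
  rw [t1a_three, t1b_three,
    show p.t1a 0 = p.e from rfl, show p.t1a 1 = p.f from rfl, show p.t1a 2 = p.b from rfl,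
    show p.t1b 0 = 1 from rfl, show p.t1b 1 = p.a - p.e + 1 from rfl, show p.t1b 2 = p.a - p.f + 1 from rfl,
    show p.f - (p.a - p.e + 1) = p.f - p.a + p.e - 1 by ring, show p.b - (p.a - p.f + 1) = p.b - p.a + p.f - 1 by ring]

/-- The packaged second-tale constant `κ(p) = ε_p (e−1)!(f−a+e−1)!(f−1)!/(g−b−1)!`. -/
def kap : ℚ := p.eps * (facZ (p.e - 1) * facZ (p.f - p.a + p.e - 1) * facZ (p.f - 1)) / facZ (p.g - p.b - 1)

/-- `ε_p Π(p)⁻¹ Π̂(p) = κ(p)`. -/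
theorem kap_eq : p.eps * (p.Pi)⁻¹ * normT p.t2a p.t2b = p.kap := by
  rw [normT_eq, Pi_eq, kap]
  have h1 := facZ_ne_zero (p.g - p.a - 1)
  have h2 := facZ_ne_zero (p.e - 1)
  have h3 := facZ_ne_zero (p.f - p.a + p.e - 1)
  have h4 := facZ_ne_zero (p.b - p.a + p.f - 1)
  have h5 := facZ_ne_zero (p.g - p.b - 1)
  have h6 := facZ_ne_zero (p.f - 1)
  rw [show p.f - p.a + p.b - 1 = p.b - p.a + p.f - 1 by ring]
  field_simp

/-- **Normal form of the second-tale value**: off the poles,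
`vR(p)(u) = κ(p) · block(a+1, g−b+a)(u) · block(a−b+1, f)(u/2) / (block(e, e+f)(u/2) · block(a, g)(u/2))`. -/
theorem vR_eval_blocks (h : AdmissibleT p.t2a p.t2b) {u : ℚ} (hu : (denT p.t2a p.t2b).eval (u / 2) ≠ 0) :
    p.vR.eval u = p.kap * ((block (p.a + 1) (p.g - p.b + p.a)).eval u * (block (p.a - p.b + 1) p.f).eval (u / 2))
      / ((block p.e (p.e + p.f)).eval (u / 2) * (block p.a p.g).eval (u / 2)) := by
  rw [p.vR_eval h hu, RT, numT_eq, denT_eq, ← kap_eq, ← eval_block2_half]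
  simp only [Polynomial.eval_mul, Polynomial.eval_C]
  ring

/-- `denT` of the hinge does not vanish at `u/2` off the translates `u + 2j ≠ 0`, `j ∈ [e, e+f) ∪ [a, g)`. -/
theorem denT_eval_ne_zero {u : ℚ} (h1 : ∀ j ∈ Ico p.e (p.e + p.f), u + 2 * j ≠ 0) (h2 : ∀ j ∈ Ico p.a p.g, u + 2 * j ≠ 0) :
    (denT p.t2a p.t2b).eval (u / 2) ≠ 0 := by
  rw [denT_eq, Polynomial.eval_mul]
  refine mul_ne_zero (eval_block_ne_zero fun i hi heq => h1 i hi ?_) (eval_block_ne_zero fun i hi heq => h2 i hi ?_)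
  · rw [show u = 2 * (u / 2) by ring, heq]; ring
  · rw [show u = 2 * (u / 2) by ring, heq]; ring

/-! ### Motion along `δ_b` -/

/-- `ε` alternates along `δ_b`: `ε(p + kδ_b) = (−1)^k ε(p)`. -/
theorem eps_addB (k : ℕ) : (p.addB k).eps = (-1) ^ k * p.eps := by
  unfold eps
  rw [neg_one_pow_natAbs, neg_one_pow_natAbs, show (p.addB k).a + (p.addB k).b + (p.addB k).e + (p.addB k).f
    = (p.a + p.b + p.e + p.f) + (k : ℕ) by simp only [addB]; ring, zpow_add₀ (by norm_num), zpow_natCast]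
  ring

/-- `κ` along `δ_b`: `κ(p + kδ_b) = (−1)^k · (g−b−k)(g−b−k+1)⋯(g−b−1) · κ(p)` (for `g − b − 1 − k ≥ 0`). -/
theorem kap_addB (k : ℕ) (h : 0 ≤ p.g - p.b - 1 - k) :
    (p.addB k).kap = (-1) ^ k * (∏ j ∈ range k, ((p.g : ℚ) - p.b - 1 - k + j + 1)) * p.kap := by
  have hf : facZ (p.g - p.b - 1) = facZ (p.g - p.b - 1 - k) * ∏ j ∈ range k, ((p.g : ℚ) - p.b - 1 - k + j + 1) := by
    have := facZ_add_nat h k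
    rw [show p.g - p.b - 1 - (k : ℤ) + k = p.g - p.b - 1 by ring] at this
    rw [this]; push_cast; ring
  unfold kap
  rw [eps_addB, hf]
  simp only [addB]
  rw [show p.g - (p.b + (k : ℤ)) - 1 = p.g - p.b - 1 - k by ring]
  have h5 := facZ_ne_zero (p.g - p.b - 1 - k)
  have hP : ∏ j ∈ range k, ((p.g : ℚ) - p.b - 1 - k + j + 1) ≠ 0 :=
    prod_ne_zero_iff.2 fun j hj => by
      have hj' := mem_range.1 hj
      have : ((p.g : ℚ) - p.b - 1 - k + j + 1) = ((p.g - p.b - 1 - k + j + 1 : ℤ) : ℚ) := by push_cast; ring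
      rw [this]; exact_mod_cast (by omega : (p.g - p.b - 1 - k + j + 1 : ℤ) ≠ 0)
  field_simp

end Pt

end Summit.KontsevichZagierPeriods.Zeta5Search.TwoTaleOmega
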